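/-
Copyright (c) 2026. All rights reserved.
Released under Apache 2.0 license as described in the file LICENSE.
-/
import Mathlib
import Literature.RingTheory.ZeroDimensional.HermiteFormReal
import Literature.RingTheory.ZeroDimensional.ScalarExtension
import Literature.LinearAlgebra.QuadraticForm.SignatureBaseChange
import HarnessLib

/-!
# The Hermite form over an ordered ground field `K ⊆ ℝ`: BPR2006 Theorem 4.100 with `K ⊊ R`
(`R = ℝ`, `C = ℂ`)

[cite: BasuPollackRoy2006, §4.6 Theorem 4.100 [Multivariate Hermite] ("Rank(Her(P, Q)) =
#{x ∈ Zer(P, C^k) | Q(x) ≠ 0}, Sign(Her(P, Q)) = TaQ(Q, P)" with "TaQ(Q, P) = Σ_{x ∈ Zer(P, R^k)}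
sign(Q(x))"), pp. 192–193; §4.5 Lemmas 4.86–4.87, p. 185]
[cite: Laurent2008, §2.4.4 Theorem 2.14, p. 24]

BPR state Theorem 4.100 for polynomials `P, Q` with coefficients in a field `K` CONTAINED IN a real
closed field `R`, `C = R[i]`: the Hermite form `Her(P, Q)` is a quadratic form over `K` on
`A = K[X]/Ideal(P, K)`, while the roots are counted in `R^k` and `C^k`.  The tree's
`Literature.RingTheory.ZeroDimensional.HermiteFormReal` is the case `K = R = ℝ`; this leaf removes
the restriction `K = R` (keeping `R = ℝ`, `C = ℂ`): for an ordered field `K` with an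
order-embedding `K → ℝ` (`[Algebra K ℝ]`, `StrictMono (algebraMap K ℝ)`; e.g. `K = ℚ`, a real
number field, `ℝ` itself), a zero-dimensional ideal `I ⊆ K[x]` and `h ∈ K[x]`, the inertia indices
of the `K`-form `S_h([f], [g]) = Tr_{A/K}(M_{fgh})` are

* `sigPos_eq` / `sigNeg_eq` — **`σ±(S_h) = #{v ∈ V_ℝ(I) | h(v) ≷ 0} + ½ · #{v ∈ V_ℂ(I) \ ℝⁿ |
  h(v) ≠ 0}`**;
* `sigPos_sub_sigNeg_eq`, `sigPos_sub_sigNeg_eq_sum_sign` — **Theorem 4.100, `Sign(Her(P, Q)) =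
  TaQ(Q, P) = Σ_{x ∈ Zer(P, ℝ^k)} sign Q(x)`**;
* `sigPos_add_sigNeg_eq` — **Theorem 4.100, `Rank(Her(P, Q)) = #{x ∈ Zer(P, ℂ^k) | Q(x) ≠ 0}`**
  (rank as `σ₊ + σ₋`);
* Corollary 2.15 (`h = 1`, the trace form `S_1` of `K[x]/I` itself): `sigPos_traceForm`,
  `sigNeg_traceForm`, `sigPos_sub_sigNeg_traceForm` (**`Sign(S_1) = |V_ℝ(I)|`**, the number of
  distinct real roots), `sigPos_add_sigNeg_traceForm` (**`rank(S_1) = |V_ℂ(I)|`**).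

Proof: the indices of inertia are invariant under the ordered base change `K → ℝ` (the tree's
`Literature.LinearAlgebra.QuadraticForm.SignatureBaseChange.sigPos_sigNeg_eq_of_baseChange`, fed
with BPR's Lemmas 4.86/4.87 and Remark 4.98 from `ScalarExtension`: `A ⊂ Ā = ℝ[x]/I·ℝ[x]` carries
`K`-independent families to `ℝ`-independent ones, `dim_ℝ Ā = dim_K A`, and
`S_h^ℝ(a, b) = S_h^K(a, b)` on `A`), and over `ℝ` they are computed by `HermiteFormReal`; finally
`Zer` of `I·ℝ[x]` over `ℝ` and over `ℂ` is `Zer` of `I` (`ScalarExtension.zeroLocus_extendIdeal`).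
-/

noncomputable section

namespace Literature.RingTheory.ZeroDimensional.HermiteFormOrderedField

open _root_.MvPolynomial Module
open Literature.RingTheory.ZeroDimensional.ScalarExtension
open Literature.LinearAlgebra.QuadraticForm (sigPos_sigNeg_eq_of_baseChange)

variable {K : Type*} [Field K] {σ : Type*}

/-- The Hermite form `S_h(a, b) = Tr(M_h a b)` is symmetric (any field). [cite: Laurent2008,
§2.4.4 ("the following symmetric bilinear form … S_h"), p. 24] -/
theorem isSymm_traceForm_compLeft_mulLeft (I : Ideal (MvPolynomial σ K)) (h : MvPolynomial σ K) :
    LinearMap.IsSymm ((Algebra.traceForm K (MvPolynomial σ K ⧸ I)).compLeft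
        (LinearMap.mulLeft K (Ideal.Quotient.mk I h))) :=
  LinearMap.isSymm_def.2 fun a b => by
    rw [RingHom.id_apply, LinearMap.BilinForm.compLeft_apply, LinearMap.BilinForm.compLeft_apply,
      LinearMap.mulLeft_apply, LinearMap.mulLeft_apply, Algebra.traceForm_apply,
      Algebra.traceForm_apply, mul_right_comm]

variable [Algebra K ℝ] (I : Ideal (MvPolynomial σ K)) [FiniteDimensional K (MvPolynomial σ K ⧸ I)]

/-- **`S_h^ℝ = S_h^K` on `A ⊂ Ā`**: for `a, b ∈ A = K[x]/I`,
`Tr_{Ā/ℝ}(M_h a b) = Tr_{A/K}(M_h a b)` (BPR Remark 4.98: the Hermite form of `P, Q ∈ K[X]` has its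
values in `K`). [cite: BasuPollackRoy2006, §4.6 Notation 4.95, Remark 4.98, p. 191] -/
theorem traceForm_compLeft_mulLeft_toExtension (h : MvPolynomial σ K) (a b : MvPolynomial σ K ⧸ I) :
    (Algebra.traceForm ℝ (MvPolynomial σ ℝ ⧸ extendIdeal ℝ I)).compLeft
        (LinearMap.mulLeft ℝ (Ideal.Quotient.mk (extendIdeal ℝ I) (map (algebraMap K ℝ) h)))
        (toExtension ℝ I a) (toExtension ℝ I b) =
      algebraMap K ℝ ((Algebra.traceForm K (MvPolynomial σ K ⧸ I)).compLeft
        (LinearMap.mulLeft K (Ideal.Quotient.mk I h)) a b) := by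
  rw [LinearMap.BilinForm.compLeft_apply, LinearMap.BilinForm.compLeft_apply,
    LinearMap.mulLeft_apply, LinearMap.mulLeft_apply, Algebra.traceForm_apply,
    Algebra.traceForm_apply, ← toExtension_mk, ← map_mul, ← map_mul, trace_toExtension]

/-- **The inertia indices of the `K`-form `S_h` equal those of the `ℝ`-form `S_h` of `I·ℝ[x]`**
(ordered base change `K → ℝ`; BPR's passage from `A` over `K` to root counts over `R ⊇ K`).
[cite: BasuPollackRoy2006, §4.6 Theorem 4.100 (statement over K ⊂ R) with §4.5 Lemmas
4.86–4.87, pp. 185, 192–193] -/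
theorem sigPos_sigNeg_eq_extension [LinearOrder K] [IsStrictOrderedRing K]
    (hmono : StrictMono (algebraMap K ℝ)) (h : MvPolynomial σ K) :
    sigPos (((Algebra.traceForm ℝ (MvPolynomial σ ℝ ⧸ extendIdeal ℝ I)).compLeft
        (LinearMap.mulLeft ℝ (Ideal.Quotient.mk (extendIdeal ℝ I)
          (map (algebraMap K ℝ) h)))).toQuadraticMap) =
      sigPos (((Algebra.traceForm K (MvPolynomial σ K ⧸ I)).compLeft
        (LinearMap.mulLeft K (Ideal.Quotient.mk I h))).toQuadraticMap) ∧
    sigNeg (((Algebra.traceForm ℝ (MvPolynomial σ ℝ ⧸ extendIdeal ℝ I)).compLeft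
        (LinearMap.mulLeft ℝ (Ideal.Quotient.mk (extendIdeal ℝ I)
          (map (algebraMap K ℝ) h)))).toQuadraticMap) =
      sigNeg (((Algebra.traceForm K (MvPolynomial σ K ⧸ I)).compLeft
        (LinearMap.mulLeft K (Ideal.Quotient.mk I h))).toQuadraticMap) := by
  haveI := finiteDimensional_extension (L := ℝ) I
  exact sigPos_sigNeg_eq_of_baseChange hmono _ (isSymm_traceForm_compLeft_mulLeft I h) _
    (isSymm_traceForm_compLeft_mulLeft (extendIdeal ℝ I) (map (algebraMap K ℝ) h))
    (toExtension ℝ I).toLinearMap.toAddMonoidHom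
    (fun a b => traceForm_compLeft_mulLeft_toExtension I h a b)
    (fun _ v hv => linearIndependent_toExtension I hv) (finrank_extension I)

/-! ## Root counts: `Zer(I·ℝ[x]) = Zer(I)` over `ℝ` and over `ℂ` -/

/-- `ℂ` is a `K`-algebra through `ℝ` compatibly. [folklore] -/
private theorem isScalarTower_real_complex : IsScalarTower K ℝ ℂ :=
  IsScalarTower.of_algebraMap_eq fun _ => rfl

/-- Evaluating `h ∈ K[x]` at a real point through `ℝ[x]`. [folklore] -/
private theorem eval_map_eq_aeval (w : σ → ℝ) (h : MvPolynomial σ K) :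
    eval w (map (algebraMap K ℝ) h) = aeval w h := by
  rw [eval_map, aeval_def]

/-- Evaluating `h ∈ K[x]` at a complex point through `ℝ[x]`. [folklore] -/
private theorem aeval_map_eq_aeval (v : σ → ℂ) (h : MvPolynomial σ K) :
    aeval v (map (algebraMap K ℝ) h) = aeval v h := by
  haveI : IsScalarTower K ℝ ℂ := isScalarTower_real_complex
  rw [aeval_def, eval₂_map, ← IsScalarTower.algebraMap_eq, ← aeval_def]

variable [LinearOrder K] [IsStrictOrderedRing K] [Fintype (zeroLocus ℝ I)] [Fintype (zeroLocus ℂ I)]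

/-- **Theorem 4.100 over `K ⊆ ℝ`, positive index: `σ₊(S_h) = #{v ∈ V_ℝ(I) | h(v) > 0} +
½ · #{v ∈ V_ℂ(I) \ ℝⁿ | h(v) ≠ 0}`** for the `K`-form `S_h` on `K[x]/I`.
[cite: BasuPollackRoy2006, §4.6 Theorem 4.100 (proof: "σ₊" count via L(y,f), L_{1,z}, L_{2,z}),
pp. 193–194; Laurent2008, §2.4.4 proof of Theorem 2.14 ("σ₊ = ρ₊ + ρ_T"), p. 25] -/
theorem sigPos_eq (hmono : StrictMono (algebraMap K ℝ)) (h : MvPolynomial σ K)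
    [DecidablePred fun w : zeroLocus ℝ I => 0 < aeval (w : σ → ℝ) h]
    [DecidablePred fun v : zeroLocus ℂ I => star (v : σ → ℂ) ≠ v ∧ aeval (v : σ → ℂ) h ≠ 0] :
    sigPos (((Algebra.traceForm K (MvPolynomial σ K ⧸ I)).compLeft
        (LinearMap.mulLeft K (Ideal.Quotient.mk I h))).toQuadraticMap) =
      Fintype.card {w : zeroLocus ℝ I // 0 < aeval (w : σ → ℝ) h} +
        Fintype.card {v : zeroLocus ℂ I // star (v : σ → ℂ) ≠ v ∧ aeval (v : σ → ℂ) h ≠ 0} / 2 := by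
  classical
  haveI : IsScalarTower K ℝ ℂ := isScalarTower_real_complex
  haveI := finiteDimensional_extension (L := ℝ) I
  letI : Fintype (zeroLocus ℝ (extendIdeal ℝ I)) :=
    Fintype.ofEquiv (zeroLocus ℝ I) (Equiv.setCongr (zeroLocus_extendIdeal I ℝ).symm)
  letI : Fintype (zeroLocus ℂ (extendIdeal ℝ I)) :=
    Fintype.ofEquiv (zeroLocus ℂ I) (Equiv.setCongr (zeroLocus_extendIdeal I ℂ).symm)
  rw [← (sigPos_sigNeg_eq_extension I hmono h).1,
    HermiteFormReal.sigPos_eq (extendIdeal ℝ I) (map (algebraMap K ℝ) h)]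
  congr 1
  · exact Fintype.card_congr (Equiv.subtypeEquiv (Equiv.setCongr (zeroLocus_extendIdeal I ℝ))
      fun w => by rw [Equiv.setCongr_apply, eval_map_eq_aeval])
  · congr 1
    exact Fintype.card_congr (Equiv.subtypeEquiv (Equiv.setCongr (zeroLocus_extendIdeal I ℂ))
      fun v => by rw [Equiv.setCongr_apply, aeval_map_eq_aeval])

/-- **Theorem 4.100 over `K ⊆ ℝ`, negative index: `σ₋(S_h) = #{v ∈ V_ℝ(I) | h(v) < 0} +
½ · #{v ∈ V_ℂ(I) \ ℝⁿ | h(v) ≠ 0}`.**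
[cite: BasuPollackRoy2006, §4.6 Theorem 4.100 (proof), pp. 193–194; Laurent2008, §2.4.4 proof
of Theorem 2.14 ("σ₋ = ρ₋ + ρ_T"), p. 25] -/
theorem sigNeg_eq (hmono : StrictMono (algebraMap K ℝ)) (h : MvPolynomial σ K)
    [DecidablePred fun w : zeroLocus ℝ I => aeval (w : σ → ℝ) h < 0]
    [DecidablePred fun v : zeroLocus ℂ I => star (v : σ → ℂ) ≠ v ∧ aeval (v : σ → ℂ) h ≠ 0] :
    sigNeg (((Algebra.traceForm K (MvPolynomial σ K ⧸ I)).compLeft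
        (LinearMap.mulLeft K (Ideal.Quotient.mk I h))).toQuadraticMap) =
      Fintype.card {w : zeroLocus ℝ I // aeval (w : σ → ℝ) h < 0} +
        Fintype.card {v : zeroLocus ℂ I // star (v : σ → ℂ) ≠ v ∧ aeval (v : σ → ℂ) h ≠ 0} / 2 := by
  classical
  haveI : IsScalarTower K ℝ ℂ := isScalarTower_real_complex
  haveI := finiteDimensional_extension (L := ℝ) I
  letI : Fintype (zeroLocus ℝ (extendIdeal ℝ I)) :=
    Fintype.ofEquiv (zeroLocus ℝ I) (Equiv.setCongr (zeroLocus_extendIdeal I ℝ).symm)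
  letI : Fintype (zeroLocus ℂ (extendIdeal ℝ I)) :=
    Fintype.ofEquiv (zeroLocus ℂ I) (Equiv.setCongr (zeroLocus_extendIdeal I ℂ).symm)
  rw [← (sigPos_sigNeg_eq_extension I hmono h).2,
    HermiteFormReal.sigNeg_eq (extendIdeal ℝ I) (map (algebraMap K ℝ) h)]
  congr 1
  · exact Fintype.card_congr (Equiv.subtypeEquiv (Equiv.setCongr (zeroLocus_extendIdeal I ℝ))
      fun w => by rw [Equiv.setCongr_apply, eval_map_eq_aeval])
  · congr 1
    exact Fintype.card_congr (Equiv.subtypeEquiv (Equiv.setCongr (zeroLocus_extendIdeal I ℂ))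
      fun v => by rw [Equiv.setCongr_apply, aeval_map_eq_aeval])

/-- **Theorem 4.100 [Multivariate Hermite] over an ordered field `K ⊆ ℝ`:
`Sign(Her(P, Q)) = σ₊ − σ₋ = #{x ∈ Zer(P, ℝ^k) | Q(x) > 0} − #{x ∈ Zer(P, ℝ^k) | Q(x) < 0}`**
for `P, Q` with coefficients in `K` (the form over `K`, the roots in `ℝ^k`).
[cite: BasuPollackRoy2006, §4.6 Theorem 4.100, pp. 192–193; Laurent2008, §2.4.4 Theorem 2.14,
p. 24] -/
theorem sigPos_sub_sigNeg_eq (hmono : StrictMono (algebraMap K ℝ)) (h : MvPolynomial σ K)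
    [DecidablePred fun w : zeroLocus ℝ I => 0 < aeval (w : σ → ℝ) h]
    [DecidablePred fun w : zeroLocus ℝ I => aeval (w : σ → ℝ) h < 0] :
    (sigPos (((Algebra.traceForm K (MvPolynomial σ K ⧸ I)).compLeft
        (LinearMap.mulLeft K (Ideal.Quotient.mk I h))).toQuadraticMap) : ℤ) -
      sigNeg (((Algebra.traceForm K (MvPolynomial σ K ⧸ I)).compLeft
        (LinearMap.mulLeft K (Ideal.Quotient.mk I h))).toQuadraticMap) =
      (Fintype.card {w : zeroLocus ℝ I // 0 < aeval (w : σ → ℝ) h} : ℤ) -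
        Fintype.card {w : zeroLocus ℝ I // aeval (w : σ → ℝ) h < 0} := by
  classical
  rw [sigPos_eq I hmono h, sigNeg_eq I hmono h]
  push_cast
  ring

/-- Theorem 4.100 in Tarski-query form over `K ⊆ ℝ`:
**`Sign(Her(P, Q)) = TaQ(Q, P) = Σ_{x ∈ Zer(P, ℝ^k)} sign Q(x)`**.
[cite: BasuPollackRoy2006, §4.6 Theorem 4.100 and the definition of TaQ(Q, P), pp. 192–193] -/
theorem sigPos_sub_sigNeg_eq_sum_sign (hmono : StrictMono (algebraMap K ℝ)) (h : MvPolynomial σ K) :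
    (sigPos (((Algebra.traceForm K (MvPolynomial σ K ⧸ I)).compLeft
        (LinearMap.mulLeft K (Ideal.Quotient.mk I h))).toQuadraticMap) : ℤ) -
      sigNeg (((Algebra.traceForm K (MvPolynomial σ K ⧸ I)).compLeft
        (LinearMap.mulLeft K (Ideal.Quotient.mk I h))).toQuadraticMap) =
      ∑ w : zeroLocus ℝ I, (SignType.sign (aeval (w : σ → ℝ) h) : ℤ) := by
  classical
  have hsign : ∀ w : zeroLocus ℝ I, (SignType.sign (aeval (w : σ → ℝ) h) : ℤ) =
      (if 0 < aeval (w : σ → ℝ) h then 1 else 0) - (if aeval (w : σ → ℝ) h < 0 then 1 else 0) := by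
    intro w
    rcases lt_trichotomy 0 (aeval (w : σ → ℝ) h) with hpos | hzero | hneg
    · rw [sign_pos hpos, if_pos hpos, if_neg (not_lt.2 hpos.le)]; simp
    · rw [← hzero, sign_zero]; simp
    · rw [sign_neg hneg, if_neg (not_lt.2 hneg.le), if_pos hneg]; simp
  rw [sigPos_sub_sigNeg_eq I hmono h, Fintype.card_subtype, Fintype.card_subtype,
    Finset.sum_congr rfl fun w _ => hsign w, Finset.sum_sub_distrib, Finset.card_filter,
    Finset.card_filter]
  push_cast
  ring

omit [Fintype (zeroLocus ℝ I)] in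
/-- **Theorem 4.100 [Multivariate Hermite] over `K ⊆ ℝ`, rank clause:
`Rank(Her(P, Q)) = σ₊ + σ₋ = #{x ∈ Zer(P, ℂ^k) | Q(x) ≠ 0}`.**
[cite: BasuPollackRoy2006, §4.6 Theorem 4.100, pp. 192–193; Laurent2008, §2.4.4 Theorem 2.14
(first identity), p. 24] -/
theorem sigPos_add_sigNeg_eq (hmono : StrictMono (algebraMap K ℝ)) (h : MvPolynomial σ K)
    [DecidablePred fun v : zeroLocus ℂ I => aeval (v : σ → ℂ) h = 0] :
    sigPos (((Algebra.traceForm K (MvPolynomial σ K ⧸ I)).compLeft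
        (LinearMap.mulLeft K (Ideal.Quotient.mk I h))).toQuadraticMap) +
      sigNeg (((Algebra.traceForm K (MvPolynomial σ K ⧸ I)).compLeft
        (LinearMap.mulLeft K (Ideal.Quotient.mk I h))).toQuadraticMap) =
      Fintype.card {v : zeroLocus ℂ I // ¬ aeval (v : σ → ℂ) h = 0} := by
  classical
  haveI : IsScalarTower K ℝ ℂ := isScalarTower_real_complex
  haveI := finiteDimensional_extension (L := ℝ) I
  letI : Fintype (zeroLocus ℂ (extendIdeal ℝ I)) :=
    Fintype.ofEquiv (zeroLocus ℂ I) (Equiv.setCongr (zeroLocus_extendIdeal I ℂ).symm)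
  rw [← (sigPos_sigNeg_eq_extension I hmono h).1, ← (sigPos_sigNeg_eq_extension I hmono h).2,
    HermiteFormReal.sigPos_add_sigNeg_eq (extendIdeal ℝ I) (map (algebraMap K ℝ) h)]
  exact Fintype.card_congr (Equiv.subtypeEquiv (Equiv.setCongr (zeroLocus_extendIdeal I ℂ))
    fun v => by rw [Equiv.setCongr_apply, aeval_map_eq_aeval])


/-! ## Corollary 2.15 over an ordered field `K ⊆ ℝ`: the trace form `S_1` itself -/

omit [Fintype (zeroLocus ℝ I)] in
/-- **Corollary 2.15 over `K ⊆ ℝ`, rank: `rank(S_1) = σ₊ + σ₋ = |V_ℂ(I)|`** — the rank of the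
trace form of `K[x]/I` is the number of distinct complex roots.
[cite: Laurent2008, §2.4.4 Corollary 2.15 ("rank(S_1) = |V_ℂ(I)|"), p. 26; BasuPollackRoy2006,
§4.6 Theorem 4.100 with Q = 1, pp. 192–193] -/
theorem sigPos_add_sigNeg_traceForm (hmono : StrictMono (algebraMap K ℝ)) :
    sigPos (Algebra.traceForm K (MvPolynomial σ K ⧸ I)).toQuadraticMap +
      sigNeg (Algebra.traceForm K (MvPolynomial σ K ⧸ I)).toQuadraticMap =
      Fintype.card (zeroLocus ℂ I) := by
  classical
  have h1 := sigPos_add_sigNeg_eq I hmono (1 : MvPolynomial σ K)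
  rw [map_one, LinearMap.mulLeft_one, LinearMap.BilinForm.compLeft_id] at h1
  rw [h1, Fintype.card_subtype, Finset.filter_true_of_mem fun v _ => by
    rw [map_one]; exact one_ne_zero, Finset.card_univ]

/-- **Corollary 2.15 over `K ⊆ ℝ`, signature: `σ₊(S_1) − σ₋(S_1) = |V_ℝ(I)|`** — the signature
of the trace form of `K[x]/I` (a form over `K`, e.g. over `ℚ`) counts the distinct REAL roots.
[cite: Laurent2008, §2.4.4 Corollary 2.15 ("σ₊(S_1) − σ₋(S_1) = |V_ℝ(I)|"), p. 26;
BasuPollackRoy2006, §4.6 Theorem 4.100 with Q = 1 ("TaQ(1, P)" = #Zer(P, R^k)), p. 193] -/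
theorem sigPos_sub_sigNeg_traceForm (hmono : StrictMono (algebraMap K ℝ)) :
    (sigPos (Algebra.traceForm K (MvPolynomial σ K ⧸ I)).toQuadraticMap : ℤ) -
      sigNeg (Algebra.traceForm K (MvPolynomial σ K ⧸ I)).toQuadraticMap =
      Fintype.card (zeroLocus ℝ I) := by
  classical
  have h1 := sigPos_sub_sigNeg_eq I hmono (1 : MvPolynomial σ K)
  rw [map_one, LinearMap.mulLeft_one, LinearMap.BilinForm.compLeft_id] at h1
  have h2 : Fintype.card {w : zeroLocus ℝ I // 0 < aeval (w : σ → ℝ) (1 : MvPolynomial σ K)} =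
      Fintype.card (zeroLocus ℝ I) := by
    rw [Fintype.card_subtype, Finset.filter_true_of_mem fun v _ => by
      rw [map_one]; exact zero_lt_one, Finset.card_univ]
  have h3 :
      Fintype.card {w : zeroLocus ℝ I // aeval (w : σ → ℝ) (1 : MvPolynomial σ K) < 0} = 0 :=
    Fintype.card_eq_zero_iff.2 ⟨fun w => absurd w.2 (by rw [map_one]; exact not_lt.2 zero_le_one)⟩
  rw [h1, h2, h3]
  simp

/-- Corollary 2.15 over `K ⊆ ℝ`, refined: **`σ₋(S_1) = ½ · |V_ℂ(I) \ ℝⁿ|`** (the number of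
complex-conjugate pairs of non-real roots). [cite: Laurent2008, §2.4.4 proof of Theorem 2.14 /
Corollary 2.15 ("σ₋ = ρ₋ + ρ_T" with ρ₋ = 0 for h = 1), pp. 25–26] -/
theorem sigNeg_traceForm (hmono : StrictMono (algebraMap K ℝ))
    [DecidablePred fun v : zeroLocus ℂ I => star (v : σ → ℂ) ≠ v] :
    sigNeg (Algebra.traceForm K (MvPolynomial σ K ⧸ I)).toQuadraticMap =
      Fintype.card {v : zeroLocus ℂ I // star (v : σ → ℂ) ≠ v} / 2 := by
  classical
  have h1 := sigNeg_eq I hmono (1 : MvPolynomial σ K)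
  rw [map_one, LinearMap.mulLeft_one, LinearMap.BilinForm.compLeft_id] at h1
  have h0 :
      Fintype.card {w : zeroLocus ℝ I // aeval (w : σ → ℝ) (1 : MvPolynomial σ K) < 0} = 0 :=
    Fintype.card_eq_zero_iff.2 ⟨fun w => absurd w.2 (by rw [map_one]; exact not_lt.2 zero_le_one)⟩
  rw [h1, h0, zero_add]
  congr 1
  exact Fintype.card_congr (Equiv.subtypeEquivRight fun v => by
    rw [map_one]; exact ⟨fun hv => hv.1, fun hv => ⟨hv, one_ne_zero⟩⟩)

/-- Corollary 2.15 over `K ⊆ ℝ`, refined: **`σ₊(S_1) = |V_ℝ(I)| + ½ · |V_ℂ(I) \ ℝⁿ|`**.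
[cite: Laurent2008, §2.4.4 proof of Theorem 2.14 / Corollary 2.15 ("σ₊ = ρ₊ + ρ_T"), pp. 25–26] -/
theorem sigPos_traceForm (hmono : StrictMono (algebraMap K ℝ))
    [DecidablePred fun v : zeroLocus ℂ I => star (v : σ → ℂ) ≠ v] :
    sigPos (Algebra.traceForm K (MvPolynomial σ K ⧸ I)).toQuadraticMap =
      Fintype.card (zeroLocus ℝ I) +
        Fintype.card {v : zeroLocus ℂ I // star (v : σ → ℂ) ≠ v} / 2 := by
  classical
  have h1 := sigPos_eq I hmono (1 : MvPolynomial σ K)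
  rw [map_one, LinearMap.mulLeft_one, LinearMap.BilinForm.compLeft_id] at h1
  have h2 : Fintype.card {w : zeroLocus ℝ I // 0 < aeval (w : σ → ℝ) (1 : MvPolynomial σ K)} =
      Fintype.card (zeroLocus ℝ I) := by
    rw [Fintype.card_subtype, Finset.filter_true_of_mem fun v _ => by
      rw [map_one]; exact zero_lt_one, Finset.card_univ]
  rw [h1, h2]
  congr 2
  exact Fintype.card_congr (Equiv.subtypeEquivRight fun v => by
    rw [map_one]; exact ⟨fun hv => hv.1, fun hv => ⟨hv, one_ne_zero⟩⟩)

end Literature.RingTheory.ZeroDimensional.HermiteFormOrderedField
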